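import Mathlib.Analysis.SpecialFunctions.Pow.Real
import Mathlib.Analysis.Calculus.FDeriv.Prod
import Mathlib.MeasureTheory.Measure.Prod
import Mathlib.MeasureTheory.Measure.Lebesgue.Basic
import Literature.Analysis.Calculus.DivCurlPlane
import Literature.Analysis.FluidPDE.MeridianReduction
import HarnessLib

/-!
# Hou's generalized `n`-dimensional axisymmetric Navier–Stokes system (real dimension `n`)

T. Y. Hou, *Nearly self-similar blowup of generalized axisymmetric Navier–Stokes equations*,
Found. Comput. Math. (2026) = arXiv:2405.10916, §1 eqs. (1.1)–(1.3) and §2.2–§2.3 (p. 8).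
In the Hou–Li variables `u₁ = u^θ/r`, `ω₁ = ω^θ/r`, `ψ₁ = ψ^θ/r` (angular velocity, vorticity and
stream function divided by `r`) and with the total circulation `Γ = r u^θ = r² u₁`, Hou's
constant-viscosity system with a **real** dimension parameter `n` (`n ≥ 2`) reads

* `Γ_t + u^r Γ_r + u^z Γ_z = ν (Γ_rr + ((n−4)/r) Γ_r + ((6−2n)/r²) Γ + Γ_zz)`      (1.1)
* `ω₁,t + u^r ω₁,r + u^z ω₁,z = (Γ²/r⁴)_z − (n−3) ψ₁,z ω₁ + ν (ω₁,rr + (n/r) ω₁,r + ω₁,zz)` (1.2)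
* `−(∂_rr + (n/r) ∂_r + ∂_zz) ψ₁ = ω₁`                          (1.3)
* `u^r = −r ψ₁,z`, `u^z = (n−1) ψ₁ + r ψ₁,r` (§2.2, p. 8: then `(r^{n−2}u^r)_r + (r^{n−2}u^z)_z = 0`),

and (1.1) is equivalent, via `Γ = r² u₁`, to the `u₁`-equation (§2.3, p. 8)

* `u₁,t + u^r u₁,r + u^z u₁,z = 2 u₁ ψ₁,z + ν (u₁,rr + (n/r) u₁,r + u₁,zz)`,    (2.x)

the source term of (1.2) being `(Γ²/r⁴)_z = (u₁²)_z` (p. 8). For `n = 3` this is exactly the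
Hou–Li (2008) reformulation of the 3-D axisymmetric Navier–Stokes equations with swirl (p. 7:
`u^r = −rψ₁,z`, `u^z = 2ψ₁ + rψ₁,r`, operators `∂_rr + (3/r)∂_r + ∂_zz`).

## Main definitions (all in `namespace Literature.Analysis.FluidPDE`)

* `derivR`, `derivZ`: the partial derivatives `∂ᵣG(r,z) = DG(r,z)(1,0)`, `∂_zG = DG(r,z)(0,1)` of
  a meridian profile `G : ℝ × ℝ → ℝ` (the convention of `MeridianReduction` /
  `ChenHouMeridianSystem`; same bodies as `Literature.Barriers.NavierStokesRegularity.derivR/Z`,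
  which live in a barrier file this topic file must not import — a librarian may merge them),
  with the slice calculus `derivR_eq_deriv`, `derivR_slice`, `derivR_derivR_slice`, … (for smooth
  profiles `∂ᵣ`, `∂ᵣ∂ᵣ` are the first/second derivatives of the slice `s ↦ G (s, z)`) and the
  product rules `derivR_sq_mul`, `derivR_derivR_sq_mul`, … for `r² G` used in the `Γ = r²u₁` algebra.
* `GeneralizedAxisymNS.lap n G = ∂_rrG + (n/r)∂ᵣG + ∂_zzG` (Hou's elliptic/diffusion operator),
  `GeneralizedAxisymNS.radialVel ψ₁ = u^r`, `….axialVel n ψ₁ = u^z`, `….circulation u₁ = Γ = r²u₁`.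
* `GeneralizedAxisymNS S n ν u₁ ω₁ ψ₁ t q`: the three equations (2.x), (1.2), (1.3) **at one
  space–time point** `(t, q)`, `q = (r, z)` (meant for `r > 0`), time derivative one-sided within
  the time set `S` (`timeDerivWithin`, the convention of `IsClassicalNSSolutionOn`).
* `GeneralizedAxisymNS.IsClassicalSolutionOn S n ν u₁ ω₁ ψ₁`: classical solutions on the time set
  `S` (typically `Ico 0 T`) over the whole half-plane `{r ≥ 0} × ℝ_z`: the three unknowns are
  jointly `C^∞` on `S × ℝ²` (`IsSmoothSpaceTimeOn`) and **even in `r`** (Hou §2.1, p. 7, after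
  Liu–Wang 2006: `u₁, ω₁, ψ₁` are even functions of `r`, pole conditions
  `u₁,r = ω₁,r = ψ₁,r = 0` at `r = 0` — for a smooth even function all odd `r`-derivatives vanish on
  the axis), and the equations hold for `t ∈ S`, `r > 0`, `z ∈ ℝ` (by evenness they then hold for
  `r < 0` too; the `1/r` terms are not evaluated on the axis).
* `GeneralizedAxisymNS.energy n u₁ ψ₁ = ∫∫_{r>0} (|u^r|² + |Γ/r|² + |u^z|²) r^{n−2} dr dz` (Hou §1
  p. 3 and §2.3 p. 8: the kinetic energy `∫ |u|² r^{n−2} dr dz = ∫ (u₁² + |∇ψ₁|²) rⁿ dr dz`,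
  conserved/dissipated for smooth solutions at fixed `n`), as a lower Lebesgue integral.
* `GeneralizedAxisymNS.HasRapidDecay G`: Schwartz-type decay of a profile on `ℝ²` (the shape of
  `HasRapidSpatialDecay`, Fefferman's (4)); `….HasRapidlyDecayingVelocity n u₁ ψ₁`: the three
  physical velocity components `u^r`, `u^θ = r u₁`, `u^z` of a time slice decay rapidly.
* `GeneralizedAxisymNS.HasSmoothExtensionPast`, `GeneralizedAxisymNS.IsMaximalSolution`: the
  continuation vocabulary, verbatim parallel to `HasSmoothExtensionPast` / `IsMaximalSmoothSolution`
  of `ClassicalSolution` (classical on `Ico 0 T`; no classical extension to a larger `Ico 0 T'`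
  agreeing on `Ico 0 T`).
* `GeneralizedAxisymNS.toVelocity u₁ ψ₁ : ℝ³ → ℝ³`: at `n = 3`, the axisymmetric velocity field
  `u = u^r e_r + r u₁ e_θ + u^z e_z` of a time slice, in the tree's frame `eR, eTheta, eZ`
  (`swirl (toVelocity u₁ ψ₁) = r² u₁ = Γ`, `swirl_toVelocity`): the vocabulary in which the `n = 3`
  dictionary with `IsClassicalNSSolutionOn`/`IsAxisymmetric` is to be stated.
* `GeneralizedAxisymNS.hopfLift m u₁ ψ₁ : ℝ^{2m+1} → ℝ^{2m+1}` and
  `GeneralizedAxisymNS.IsHopfEquivariant m u`: at odd `n = 2m+1`, the lift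
  `u = −ψ₁,z ζ + u₁ Jζ + u^z e_z` on `ℂ^m × ℝ` (`J` = `hopfJ`, the complex structure; `Jζ` the Hopf
  field) and `U(m)`-equivariance (equivariance under linear isometries fixing `e_z` and commuting
  with `J`); `hopfLift 1 = toVelocity` (`hopfLift_one`). Vocabulary only: the dictionary
  "solutions at `n = 2m+1` ↔ Hopf-equivariant classical Navier–Stokes solutions on `ℝ^{2m+1}`" is a
  route-level claim and is not stated here.

## Design notes

* **Unknowns.** The primary unknowns are `(u₁, ω₁, ψ₁)`, on which Hou states the regularity (even
  in `r`, §2.1) and performs the energy estimate (§2.3); `Γ = r² u₁` is the derived field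
  `circulation u₁`, and the `Γ`-form (1.1) of the first equation is *proved* from (2.x) for classical
  solutions (`IsClassicalSolutionOn.circulation_eq`, with the pointwise `circulation_eq_iff`); Hou,
  p. 5: "the `(u₁,ω₁,ψ₁)` formulation is equivalent to `(Γ,ω₁,ψ₁)` formulation at the continuous
  level". The source term of (1.2) is written `(u₁²)_z` as printed on p. 8.
* **Profiles are functions on `ℝ × ℝ`** (`q = (r, z)`, time first: `u₁ : ℝ → ℝ × ℝ → ℝ`), the
  convention of `MeridianReduction`, so that `IsSmoothSpaceTimeOn`, `timeDerivWithin`,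
  `convect_comp_meridian` apply verbatim; values at `r < 0` are tied to `r > 0` by evenness, values
  at `t ∉ S` are unconstrained (junk, as in `IsClassicalNSSolutionOn`).
* **Domain.** Whole half-plane (the `ℝⁿ`-type problem); Hou computes in the periodic cylinder
  `{0 ≤ r ≤ 1} × ℝ/ℤ` with no-slip at `r = 1` (§2.1) — a cylinder variant is not defined here.
* **Not here** (deliberately): well-posedness; the dynamic-rescaling / self-similar profile
  equations (§3); the `n = 3` equivalence with axisymmetric Navier–Stokes (Hou–Li 2008) and the
  odd-`n` dictionary with `U(m)`-equivariant Navier–Stokes on `ℂ^m × ℝ` (a route-level claim, not in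
  print) — only the reconstruction maps `toVelocity` (`n = 3`) and `hopfLift` (`n = 2m+1`) are
  provided, with `divergence_free` (Hou, p. 8: incompressibility holds exactly) as a check.

## Mathlib search

Mathlib (this pin) has no Navier–Stokes or axisymmetric-flow notions (`lean search` for
`GeneralizedAxisym`, `HouLi`, `axisym` in Mathlib: nothing). Used: `fderiv`, `derivWithin`,
`ContDiffOn` (through `IsSmoothSpaceTimeOn`), `iteratedFDeriv`, `Real.rpow`, `MeasureTheory.lintegral`.

## References

* T. Y. Hou, *Nearly self-similar blowup of generalized axisymmetric Navier–Stokes equations*,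
  Found. Comput. Math. (2026), doi:10.1007/s10208-026-09748-8 = arXiv:2405.10916: §1 (1.1)–(1.3)
  (p. 3), §2 (p. 7: Hou–Li variables, §2.1 evenness/pole conditions), §2.2–§2.3 (p. 8). [Hou2026]
* T. Y. Hou, R. Li, *Dynamic stability of the three-dimensional axisymmetric Navier–Stokes
  equations with swirl*, Comm. Pure Appl. Math. 61 (2008) (the `(u₁, ω₁, ψ₁)` reformulation).
* J.-G. Liu, W.-C. Wang, *Convergence analysis of the energy and helicity preserving scheme for
  axisymmetric flows*, SIAM J. Numer. Anal. 44 (2006) (parity/pole conditions at the axis).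
-/

noncomputable section

open Set Function MeasureTheory
open scoped ContDiff ENNReal

namespace Literature.Analysis.FluidPDE

/-! ### Partial derivatives of meridian profiles -/

/-- The radial partial derivative `∂ᵣ G (r, z) = DG(r,z)(1, 0)` of a profile on the meridian
plane (Fréchet derivative, junk `0` where `G` is not differentiable; the convention
`∂ᵣ = D(·)(1,0)` of `MeridianReduction`). [folklore] -/
def derivR (G : ℝ × ℝ → ℝ) (q : ℝ × ℝ) : ℝ :=
  fderiv ℝ G q (1, 0)

/-- The axial partial derivative `∂_z G (r, z) = DG(r,z)(0, 1)` (`MeridianReduction` convention).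
[folklore] -/
def derivZ (G : ℝ × ℝ → ℝ) (q : ℝ × ℝ) : ℝ :=
  fderiv ℝ G q (0, 1)

/-- Unfolding `derivR`. [folklore] -/
theorem derivR_apply (G : ℝ × ℝ → ℝ) (q : ℝ × ℝ) : derivR G q = fderiv ℝ G q (1, 0) := rfl

/-- Unfolding `derivZ`. [folklore] -/
theorem derivZ_apply (G : ℝ × ℝ → ℝ) (q : ℝ × ℝ) : derivZ G q = fderiv ℝ G q (0, 1) := rfl

/-- Constants have `∂ᵣ = 0`. [folklore] -/
@[simp] theorem derivR_const (c : ℝ) : derivR (fun _ => c) = fun _ => 0 := by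
  funext q; simp [derivR]

/-- Constants have `∂_z = 0`. [folklore] -/
@[simp] theorem derivZ_const (c : ℝ) : derivZ (fun _ => c) = fun _ => 0 := by
  funext q; simp [derivZ]

/-- The derivative along `(a, b)` splits as `a ∂ᵣG + b ∂_zG` (linearity of `DG(q)`), so that the
material derivative `DG(q)(u^r, u^z)` of `convect_comp_meridian` reads `u^r ∂ᵣG + u^z ∂_zG`.
[folklore] -/
theorem fderiv_apply_eq_derivR_derivZ (G : ℝ × ℝ → ℝ) (q : ℝ × ℝ) (a b : ℝ) :
    fderiv ℝ G q (a, b) = a * derivR G q + b * derivZ G q := by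
  have : ((a, b) : ℝ × ℝ) = a • ((1 : ℝ), (0 : ℝ)) + b • ((0 : ℝ), (1 : ℝ)) := by ext <;> simp
  rw [this, map_add, map_smul, map_smul]
  rfl

/-- `∂ᵣ` is the derivative along the coordinate line `r ↦ G (r, z)` wherever `G` is
(Fréchet) differentiable (chain rule with the affine line `r ↦ (r, z)`). [folklore] -/
theorem derivR_eq_deriv {G : ℝ × ℝ → ℝ} {q : ℝ × ℝ} (hG : DifferentiableAt ℝ G q) :
    derivR G q = deriv (fun r => G (r, q.2)) q.1 := by
  have hl : HasDerivAt (fun r : ℝ => ((r, q.2) : ℝ × ℝ)) ((1 : ℝ), (0 : ℝ)) q.1 :=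
    (hasDerivAt_id q.1).prodMk (hasDerivAt_const q.1 q.2)
  have h := hG.hasFDerivAt.comp_hasDerivAt q.1 hl
  exact (h.deriv).symm

/-- `∂_z` is the derivative along the coordinate line `z ↦ G (r, z)` wherever `G` is
differentiable. [folklore] -/
theorem derivZ_eq_deriv {G : ℝ × ℝ → ℝ} {q : ℝ × ℝ} (hG : DifferentiableAt ℝ G q) :
    derivZ G q = deriv (fun z => G (q.1, z)) q.2 := by
  have hl : HasDerivAt (fun z : ℝ => ((q.1, z) : ℝ × ℝ)) ((0 : ℝ), (1 : ℝ)) q.2 :=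
    (hasDerivAt_const q.2 q.1).prodMk (hasDerivAt_id q.2)
  have h := hG.hasFDerivAt.comp_hasDerivAt q.2 hl
  exact (h.deriv).symm

/-! ### Calculus of meridian profiles: slices and iterated partial derivatives -/

section Calculus

variable {G : ℝ × ℝ → ℝ}

/-- Slices `r ↦ G (r, z)` of a smooth profile are smooth. [folklore] -/
theorem contDiff_slice_fst (hG : ContDiff ℝ ∞ G) (z : ℝ) : ContDiff ℝ ∞ fun r => G (r, z) :=
  hG.comp (contDiff_id.prodMk contDiff_const)

/-- Slices `z ↦ G (r, z)` of a smooth profile are smooth. [folklore] -/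
theorem contDiff_slice_snd (hG : ContDiff ℝ ∞ G) (r : ℝ) : ContDiff ℝ ∞ fun z => G (r, z) :=
  hG.comp (contDiff_const.prodMk contDiff_id)

/-- `∂ᵣ` of a smooth profile is smooth. [folklore] -/
theorem contDiff_derivR (hG : ContDiff ℝ ∞ G) : ContDiff ℝ ∞ (derivR G) :=
  (hG.fderiv_right (m := ∞) (by exact_mod_cast le_top)).clm_apply contDiff_const

/-- `∂_z` of a smooth profile is smooth. [folklore] -/
theorem contDiff_derivZ (hG : ContDiff ℝ ∞ G) : ContDiff ℝ ∞ (derivZ G) :=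
  (hG.fderiv_right (m := ∞) (by exact_mod_cast le_top)).clm_apply contDiff_const

/-- For a smooth profile, `∂ᵣG(r, z)` is the derivative of the slice `s ↦ G (s, z)` at `r`. [folklore] -/
theorem derivR_slice (hG : ContDiff ℝ ∞ G) (r z : ℝ) :
    derivR G (r, z) = deriv (fun s => G (s, z)) r :=
  derivR_eq_deriv ((hG.differentiable (by simp)) (r, z))

/-- For a smooth profile, `∂_zG(r, z)` is the derivative of the slice `s ↦ G (r, s)` at `z`. [folklore] -/
theorem derivZ_slice (hG : ContDiff ℝ ∞ G) (r z : ℝ) :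
    derivZ G (r, z) = deriv (fun s => G (r, s)) z :=
  derivZ_eq_deriv ((hG.differentiable (by simp)) (r, z))

/-- `∂ᵣ∂ᵣG(r, z)` is the second derivative of the slice `s ↦ G (s, z)`. [folklore] -/
theorem derivR_derivR_slice (hG : ContDiff ℝ ∞ G) (r z : ℝ) :
    derivR (derivR G) (r, z) = deriv (deriv fun s => G (s, z)) r := by
  rw [derivR_slice (contDiff_derivR hG)]
  congr 1
  funext s
  exact derivR_slice hG s z

/-- `∂_z∂_zG(r, z)` is the second derivative of the slice `s ↦ G (r, s)`. [folklore] -/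
theorem derivZ_derivZ_slice (hG : ContDiff ℝ ∞ G) (r z : ℝ) :
    derivZ (derivZ G) (r, z) = deriv (deriv fun s => G (r, s)) z := by
  rw [derivZ_slice (contDiff_derivZ hG)]
  congr 1
  funext s
  exact derivZ_slice hG r s

/-- One-variable product rule `(s² g)' = 2 s g + s² g'`. [folklore] -/
theorem deriv_sq_mul {g : ℝ → ℝ} {r : ℝ} (hg : DifferentiableAt ℝ g r) :
    deriv (fun s => s ^ 2 * g s) r = 2 * r * g r + r ^ 2 * deriv g r := by
  have h : HasDerivAt (fun s => s ^ 2 * g s) (((2 : ℕ) : ℝ) * r ^ (2 - 1) * g r + r ^ 2 * deriv g r) r :=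
    (hasDerivAt_pow 2 r).mul hg.hasDerivAt
  rw [h.deriv]
  simp only [Nat.cast_ofNat, Nat.add_one_sub_one, pow_one]

/-- One-variable rule `(s² g)'' = 2 g + 4 s g' + s² g''`. [folklore] -/
theorem deriv_deriv_sq_mul {g : ℝ → ℝ} (hg : Differentiable ℝ g) {r : ℝ}
    (hg' : DifferentiableAt ℝ (deriv g) r) :
    deriv (deriv fun s => s ^ 2 * g s) r =
      2 * g r + 4 * r * deriv g r + r ^ 2 * deriv (deriv g) r := by
  have h1 : deriv (fun s => s ^ 2 * g s) = fun s => 2 * s * g s + s ^ 2 * deriv g s :=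
    funext fun s => deriv_sq_mul (hg s)
  rw [h1]
  have hA : HasDerivAt (fun s => 2 * s * g s) (2 * 1 * g r + 2 * r * deriv g r) r :=
    (((hasDerivAt_id r).const_mul 2).mul (hg r).hasDerivAt)
  have hB : HasDerivAt (fun s => s ^ 2 * deriv g s)
      (((2 : ℕ) : ℝ) * r ^ (2 - 1) * deriv g r + r ^ 2 * deriv (deriv g) r) r :=
    (hasDerivAt_pow 2 r).mul hg'.hasDerivAt
  have h : HasDerivAt (fun s => 2 * s * g s + s ^ 2 * deriv g s)
      (2 * 1 * g r + 2 * r * deriv g r +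
        (((2 : ℕ) : ℝ) * r ^ (2 - 1) * deriv g r + r ^ 2 * deriv (deriv g) r)) r :=
    hA.add hB
  rw [h.deriv]
  simp only [Nat.cast_ofNat, Nat.add_one_sub_one, pow_one]
  ring

/-- `∂ᵣ(r² G) = 2 r G + r² ∂ᵣG` for a smooth profile `G`. [folklore] -/
theorem derivR_sq_mul (hG : ContDiff ℝ ∞ G) (q : ℝ × ℝ) :
    derivR (fun q' => q'.1 ^ 2 * G q') q = 2 * q.1 * G q + q.1 ^ 2 * derivR G q := by
  have hΓ : ContDiff ℝ ∞ (fun q' : ℝ × ℝ => q'.1 ^ 2 * G q') := (contDiff_fst.pow 2).mul hG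
  obtain ⟨r, z⟩ := q
  rw [derivR_slice hΓ, derivR_slice hG]
  exact deriv_sq_mul ((contDiff_slice_fst hG z).differentiable (by simp) r)

/-- `∂_z(r² G) = r² ∂_zG` for a smooth profile `G`. [folklore] -/
theorem derivZ_sq_mul (hG : ContDiff ℝ ∞ G) (q : ℝ × ℝ) :
    derivZ (fun q' => q'.1 ^ 2 * G q') q = q.1 ^ 2 * derivZ G q := by
  have hΓ : ContDiff ℝ ∞ (fun q' : ℝ × ℝ => q'.1 ^ 2 * G q') := (contDiff_fst.pow 2).mul hG
  obtain ⟨r, z⟩ := q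
  rw [derivZ_slice hΓ, derivZ_slice hG]
  exact deriv_const_mul_field (r ^ 2)

/-- `∂ᵣ∂ᵣ(r² G) = 2 G + 4 r ∂ᵣG + r² ∂ᵣ∂ᵣG` for a smooth profile `G`. [folklore] -/
theorem derivR_derivR_sq_mul (hG : ContDiff ℝ ∞ G) (q : ℝ × ℝ) :
    derivR (derivR fun q' => q'.1 ^ 2 * G q') q =
      2 * G q + 4 * q.1 * derivR G q + q.1 ^ 2 * derivR (derivR G) q := by
  have hΓ : ContDiff ℝ ∞ (fun q' : ℝ × ℝ => q'.1 ^ 2 * G q') := (contDiff_fst.pow 2).mul hG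
  obtain ⟨r, z⟩ := q
  rw [derivR_derivR_slice hΓ, derivR_derivR_slice hG, derivR_slice hG]
  have hg : ContDiff ℝ ∞ (fun s => G (s, z)) := contDiff_slice_fst hG z
  exact deriv_deriv_sq_mul (hg.differentiable (by simp))
    ((contDiff_infty_iff_deriv.1 hg).2.differentiable (by simp) r)

/-- `∂_z∂_z(r² G) = r² ∂_z∂_zG` for a smooth profile `G`. [folklore] -/
theorem derivZ_derivZ_sq_mul (hG : ContDiff ℝ ∞ G) (q : ℝ × ℝ) :
    derivZ (derivZ fun q' => q'.1 ^ 2 * G q') q = q.1 ^ 2 * derivZ (derivZ G) q := by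
  have hΓ : ContDiff ℝ ∞ (fun q' : ℝ × ℝ => q'.1 ^ 2 * G q') := (contDiff_fst.pow 2).mul hG
  obtain ⟨r, z⟩ := q
  rw [derivZ_derivZ_slice hΓ, derivZ_derivZ_slice hG]
  have h1 : deriv (fun s => r ^ 2 * G (r, s)) = fun s => r ^ 2 * deriv (fun s => G (r, s)) s :=
    deriv_const_mul_field' (r ^ 2)
  simp only [h1]
  exact deriv_const_mul_field (r ^ 2)

/-- **Mixed partials commute** for smooth profiles: `∂ᵣ∂_zG = ∂_z∂ᵣG` (symmetry of the second
derivative, Mathlib `ContDiffAt.isSymmSndFDerivAt`, through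
`Literature.Analysis.Calculus.fderiv_fderiv_apply_const`). [folklore] -/
theorem derivR_derivZ_comm (hG : ContDiff ℝ ∞ G) (q : ℝ × ℝ) :
    derivR (derivZ G) q = derivZ (derivR G) q := by
  have h2 : ContDiff ℝ 2 G := hG.of_le (WithTop.coe_le_coe.2 le_top)
  show fderiv ℝ (fun y => fderiv ℝ G y (0, 1)) q (1, 0) =
    fderiv ℝ (fun y => fderiv ℝ G y (1, 0)) q (0, 1)
  rw [Calculus.fderiv_fderiv_apply_const h2, Calculus.fderiv_fderiv_apply_const h2]
  exact (h2.contDiffAt.isSymmSndFDerivAt (by simp)) (1, 0) (0, 1)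

end Calculus

namespace GeneralizedAxisymNS

/-! ### Hou's operators and the derived fields -/

/-- Hou's elliptic/diffusion operator `L_n G = ∂_rrG + (n/r) ∂ᵣG + ∂_zzG` with the real dimension
parameter `n` (arXiv:2405.10916, (1.2)–(1.3) and p. 8; for `n = 3` the Hou–Li operator
`∂_rr + (3/r)∂_r + ∂_zz`, p. 7). The `1/r` coefficient is junk (`= 0`) on the axis `r = 0`, where
the operator is never evaluated. [cite: Hou2026, §1 eqs. (1.2)–(1.3)] -/
def lap (n : ℝ) (G : ℝ × ℝ → ℝ) (q : ℝ × ℝ) : ℝ :=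
  derivR (derivR G) q + n / q.1 * derivR G q + derivZ (derivZ G) q

/-- The radial velocity `u^r = −r ψ₁,z` of the (time slice of the) stream variable `ψ₁`
(arXiv:2405.10916, §2.2 p. 8, below the system). [cite: Hou2026, §2.2 p. 8] -/
def radialVel (ψ₁ : ℝ × ℝ → ℝ) (q : ℝ × ℝ) : ℝ :=
  -(q.1 * derivZ ψ₁ q)

/-- The axial velocity `u^z = (n−1) ψ₁ + r ψ₁,r` (arXiv:2405.10916, §2.2 p. 8; `n = 3`:
`u^z = 2ψ₁ + rψ₁,r`, p. 7). [cite: Hou2026, §2.2 p. 8] -/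
def axialVel (n : ℝ) (ψ₁ : ℝ × ℝ → ℝ) (q : ℝ × ℝ) : ℝ :=
  (n - 1) * ψ₁ q + q.1 * derivR ψ₁ q

/-- The swirl (angular) velocity `u^θ = r u₁` of the Hou–Li variable `u₁ = u^θ/r`
(arXiv:2405.10916, §1 p. 3). [cite: Hou2026, §1 p. 3] -/
def swirlVel (u₁ : ℝ × ℝ → ℝ) (q : ℝ × ℝ) : ℝ :=
  q.1 * u₁ q

/-- The total circulation `Γ = r u^θ = r² u₁` as a time-dependent profile
(arXiv:2405.10916, §1 p. 3: "Denote by `Γ = r u^θ` the total circulation", `u₁ = u^θ/r`).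
[cite: Hou2026, §1 p. 3] -/
def circulation (u₁ : ℝ → ℝ × ℝ → ℝ) (t : ℝ) (q : ℝ × ℝ) : ℝ :=
  q.1 ^ 2 * u₁ t q

/-- Unfolding `circulation`: `Γ = r² u₁`. [folklore] -/
@[simp] theorem circulation_apply (u₁ : ℝ → ℝ × ℝ → ℝ) (t : ℝ) (q : ℝ × ℝ) :
    circulation u₁ t q = q.1 ^ 2 * u₁ t q := rfl

/-- `Γ = r u^θ`. [folklore] -/
theorem circulation_eq_mul_swirlVel (u₁ : ℝ → ℝ × ℝ → ℝ) (t : ℝ) (q : ℝ × ℝ) :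
    circulation u₁ t q = q.1 * swirlVel (u₁ t) q := by
  simp [swirlVel, sq, mul_assoc]

/-- At `n = 3` the axial velocity is the Hou–Li one, `u^z = 2ψ₁ + rψ₁,r`
(arXiv:2405.10916, p. 7). [cite: Hou2026, §2 p. 7] -/
theorem axialVel_three (ψ₁ : ℝ × ℝ → ℝ) (q : ℝ × ℝ) :
    axialVel 3 ψ₁ q = 2 * ψ₁ q + q.1 * derivR ψ₁ q := by
  simp only [axialVel]; norm_num

/-- The radial velocity of a smooth stream slice is smooth. [folklore] -/
theorem contDiff_radialVel {ψ₁ : ℝ × ℝ → ℝ} (hψ : ContDiff ℝ ∞ ψ₁) : ContDiff ℝ ∞ (radialVel ψ₁) :=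
  (contDiff_fst.mul (contDiff_derivZ hψ)).neg

/-- The axial velocity of a smooth stream slice is smooth. [folklore] -/
theorem contDiff_axialVel (n : ℝ) {ψ₁ : ℝ × ℝ → ℝ} (hψ : ContDiff ℝ ∞ ψ₁) :
    ContDiff ℝ ∞ (axialVel n ψ₁) :=
  (contDiff_const.mul hψ).add (contDiff_fst.mul (contDiff_derivR hψ))

/-- `∂ᵣu^r = −ψ₁,z − r ∂ᵣ∂_zψ₁` for a smooth stream slice. [folklore] -/
theorem derivR_radialVel {ψ₁ : ℝ × ℝ → ℝ} (hψ : ContDiff ℝ ∞ ψ₁) (q : ℝ × ℝ) :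
    derivR (radialVel ψ₁) q = -(derivZ ψ₁ q + q.1 * derivR (derivZ ψ₁) q) := by
  obtain ⟨r, z⟩ := q
  rw [derivR_slice (contDiff_radialVel hψ), derivR_slice (contDiff_derivZ hψ)]
  have hd : HasDerivAt (fun s => derivZ ψ₁ (s, z)) (deriv (fun s => derivZ ψ₁ (s, z)) r) r :=
    ((contDiff_slice_fst (contDiff_derivZ hψ) z).differentiable (by simp) r).hasDerivAt
  have h : HasDerivAt (fun s => -(s * derivZ ψ₁ (s, z)))
      (-(1 * derivZ ψ₁ (r, z) + r * deriv (fun s => derivZ ψ₁ (s, z)) r)) r :=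
    ((hasDerivAt_id r).mul hd).neg
  rw [show (fun s => radialVel ψ₁ (s, z)) = fun s => -(s * derivZ ψ₁ (s, z)) from rfl, h.deriv,
    one_mul]

/-- `∂_zu^z = (n−1)ψ₁,z + r ∂_z∂ᵣψ₁` for a smooth stream slice. [folklore] -/
theorem derivZ_axialVel (n : ℝ) {ψ₁ : ℝ × ℝ → ℝ} (hψ : ContDiff ℝ ∞ ψ₁) (q : ℝ × ℝ) :
    derivZ (axialVel n ψ₁) q = (n - 1) * derivZ ψ₁ q + q.1 * derivZ (derivR ψ₁) q := by
  obtain ⟨r, z⟩ := q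
  rw [derivZ_slice (contDiff_axialVel n hψ), derivZ_slice hψ, derivZ_slice (contDiff_derivR hψ)]
  have hd1 : HasDerivAt (fun s => ψ₁ (r, s)) (deriv (fun s => ψ₁ (r, s)) z) z :=
    ((contDiff_slice_snd hψ r).differentiable (by simp) z).hasDerivAt
  have hd2 : HasDerivAt (fun s => derivR ψ₁ (r, s)) (deriv (fun s => derivR ψ₁ (r, s)) z) z :=
    ((contDiff_slice_snd (contDiff_derivR hψ) r).differentiable (by simp) z).hasDerivAt
  have h : HasDerivAt (fun s => (n - 1) * ψ₁ (r, s) + r * derivR ψ₁ (r, s))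
      ((n - 1) * deriv (fun s => ψ₁ (r, s)) z + r * deriv (fun s => derivR ψ₁ (r, s)) z) z :=
    (hd1.const_mul (n - 1)).add (hd2.const_mul r)
  rw [show (fun s => axialVel n ψ₁ (r, s)) = fun s => (n - 1) * ψ₁ (r, s) + r * derivR ψ₁ (r, s)
    from rfl, h.deriv]

/-- **Incompressibility** (arXiv:2405.10916, §1 p. 3 and §2.2 p. 8: "The divergence free condition
`∇·u = (r^{n−2}u^r)_r/r^{n−2} + (r^{n−2}u^z)_z/r^{n−2} = 0` is satisfied exactly"), in the expanded
form `∂ᵣu^r + ((n−2)/r) u^r + ∂_zu^z = 0` off the axis, for every smooth stream slice `ψ₁` and every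
real `n` (by the symmetry of mixed partials). [cite: Hou2026, §2.2 p. 8] -/
theorem divergence_free (n : ℝ) {ψ₁ : ℝ × ℝ → ℝ} (hψ : ContDiff ℝ ∞ ψ₁) {q : ℝ × ℝ}
    (hq : q.1 ≠ 0) :
    derivR (radialVel ψ₁) q + (n - 2) / q.1 * radialVel ψ₁ q + derivZ (axialVel n ψ₁) q = 0 := by
  rw [derivR_radialVel hψ, derivZ_axialVel n hψ, derivR_derivZ_comm hψ]
  simp only [radialVel]
  field_simp
  ring

end GeneralizedAxisymNS

/-! ### The system at a point, and classical solutions -/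

/-- **Hou's generalized `n`-dimensional axisymmetric Navier–Stokes equations at the space–time
point `(t, q)`, `q = (r, z)`** (arXiv:2405.10916, §1 (1.1)–(1.3) with (1.1) in its equivalent
`u₁`-form of §2.3, p. 8), for the unknowns `u₁ ω₁ ψ₁ : ℝ → ℝ × ℝ → ℝ` (time first), real
dimension `n` and viscosity `ν`; `u^r = radialVel (ψ₁ t)`, `u^z = axialVel n (ψ₁ t)`, the time
derivative is one-sided within the time set `S`. Meant for `r = q.1 > 0` (the `1/r` coefficients
are junk on the axis). [cite: Hou2026, §1 eqs. (1.1)–(1.3); §2.3 p. 8] -/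
structure GeneralizedAxisymNS (S : Set ℝ) (n ν : ℝ) (u₁ ω₁ ψ₁ : ℝ → ℝ × ℝ → ℝ) (t : ℝ)
    (q : ℝ × ℝ) : Prop where
  /-- The `u₁`-equation `u₁,t + u^r u₁,r + u^z u₁,z = 2u₁ψ₁,z + ν(u₁,rr + (n/r)u₁,r + u₁,zz)`
  (§2.3, p. 8; equivalent to (1.1) for `Γ = r²u₁`). -/
  swirl_eq : timeDerivWithin S u₁ t q +
      GeneralizedAxisymNS.radialVel (ψ₁ t) q * derivR (u₁ t) q +
      GeneralizedAxisymNS.axialVel n (ψ₁ t) q * derivZ (u₁ t) q =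
    2 * u₁ t q * derivZ (ψ₁ t) q + ν * GeneralizedAxisymNS.lap n (u₁ t) q
  /-- The `ω₁`-equation (1.2):
  `ω₁,t + u^r ω₁,r + u^z ω₁,z = (u₁²)_z − (n−3)ψ₁,z ω₁ + ν(ω₁,rr + (n/r)ω₁,r + ω₁,zz)`
  (source term `(Γ²/r⁴)_z = (u₁²)_z`, p. 8). -/
  vorticity_eq : timeDerivWithin S ω₁ t q +
      GeneralizedAxisymNS.radialVel (ψ₁ t) q * derivR (ω₁ t) q +
      GeneralizedAxisymNS.axialVel n (ψ₁ t) q * derivZ (ω₁ t) q =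
    derivZ (fun q' => u₁ t q' ^ 2) q - (n - 3) * derivZ (ψ₁ t) q * ω₁ t q +
      ν * GeneralizedAxisymNS.lap n (ω₁ t) q
  /-- The elliptic equation (1.3): `−(ψ₁,rr + (n/r)ψ₁,r + ψ₁,zz) = ω₁`. -/
  stream_eq : -GeneralizedAxisymNS.lap n (ψ₁ t) q = ω₁ t q

namespace GeneralizedAxisymNS

/-- **Classical solutions of Hou's generalized axisymmetric Navier–Stokes system on the time set
`S`** (typically `Ico 0 T`) over the whole meridian half-plane `{r ≥ 0} × ℝ_z`
(arXiv:2405.10916, §1 (1.1)–(1.3), §2.1–§2.3): the unknowns `u₁, ω₁, ψ₁` are jointly `C^∞` on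
`S × ℝ²` and even in `r` for `t ∈ S` (§2.1, p. 7, after Liu–Wang 2006: `u^θ, ω^θ, ψ^θ` are odd in
`r`, so `u₁, ω₁, ψ₁` are even, with the pole conditions `u₁,r = ω₁,r = ψ₁,r = 0` at `r = 0`), and
the three equations hold at every `t ∈ S`, `r > 0`, `z` (hence at `r < 0` by evenness — every
term has a definite parity; they are *not* imposed on the axis, where `lap` carries the junk
coefficient `n/0 = 0`: there they hold by continuity in the limiting form with `(n+1)∂_rr`).
Initial data are not part of the structure (statements add `u₁ 0 = …`), as for
`IsClassicalNSSolutionOn`. [cite: Hou2026, §1 eqs. (1.1)–(1.3); §2.1 p. 7] -/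
structure IsClassicalSolutionOn (S : Set ℝ) (n ν : ℝ) (u₁ ω₁ ψ₁ : ℝ → ℝ × ℝ → ℝ) : Prop where
  /-- `u₁` is jointly smooth on `S × ℝ²`. -/
  smooth_u₁ : IsSmoothSpaceTimeOn S u₁
  /-- `ω₁` is jointly smooth on `S × ℝ²`. -/
  smooth_ω₁ : IsSmoothSpaceTimeOn S ω₁
  /-- `ψ₁` is jointly smooth on `S × ℝ²`. -/
  smooth_ψ₁ : IsSmoothSpaceTimeOn S ψ₁
  /-- `u₁` is even in `r` (§2.1). -/
  even_u₁ : ∀ t ∈ S, ∀ r z : ℝ, u₁ t (-r, z) = u₁ t (r, z)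
  /-- `ω₁` is even in `r` (§2.1). -/
  even_ω₁ : ∀ t ∈ S, ∀ r z : ℝ, ω₁ t (-r, z) = ω₁ t (r, z)
  /-- `ψ₁` is even in `r` (§2.1). -/
  even_ψ₁ : ∀ t ∈ S, ∀ r z : ℝ, ψ₁ t (-r, z) = ψ₁ t (r, z)
  /-- The equations (1.1)/(2.x), (1.2), (1.3) hold for `t ∈ S`, `r > 0`, `z ∈ ℝ`. -/
  equations : ∀ t ∈ S, ∀ q : ℝ × ℝ, 0 < q.1 → GeneralizedAxisymNS S n ν u₁ ω₁ ψ₁ t q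

variable {S S' : Set ℝ} {n ν : ℝ} {u₁ ω₁ ψ₁ : ℝ → ℝ × ℝ → ℝ}

/-- The time slices `u₁ t`, `t ∈ S`, of a classical solution are smooth. [folklore] -/
theorem IsClassicalSolutionOn.contDiff_u₁ (h : IsClassicalSolutionOn S n ν u₁ ω₁ ψ₁) {t : ℝ}
    (ht : t ∈ S) : ContDiff ℝ ∞ (u₁ t) :=
  h.smooth_u₁.contDiff_slice ht

/-- The time slices `ω₁ t`, `t ∈ S`, of a classical solution are smooth. [folklore] -/
theorem IsClassicalSolutionOn.contDiff_ω₁ (h : IsClassicalSolutionOn S n ν u₁ ω₁ ψ₁) {t : ℝ}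
    (ht : t ∈ S) : ContDiff ℝ ∞ (ω₁ t) :=
  h.smooth_ω₁.contDiff_slice ht

/-- The time slices `ψ₁ t`, `t ∈ S`, of a classical solution are smooth. [folklore] -/
theorem IsClassicalSolutionOn.contDiff_ψ₁ (h : IsClassicalSolutionOn S n ν u₁ ω₁ ψ₁) {t : ℝ}
    (ht : t ∈ S) : ContDiff ℝ ∞ (ψ₁ t) :=
  h.smooth_ψ₁.contDiff_slice ht

/-- Restriction of the time set: a classical solution on `S` is one on any `S' ⊆ S` of unique
differentiability (`Icc a b`, `Ico a b`, … with `a < b`, or `S'` open); needed because the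
one-sided time derivative depends on the time set (cf. `IsClassicalNSSolutionOn.mono`). [folklore] -/
theorem IsClassicalSolutionOn.mono (h : IsClassicalSolutionOn S n ν u₁ ω₁ ψ₁) (hS' : S' ⊆ S)
    (hU : UniqueDiffOn ℝ S') : IsClassicalSolutionOn S' n ν u₁ ω₁ ψ₁ where
  smooth_u₁ := h.smooth_u₁.mono hS'
  smooth_ω₁ := h.smooth_ω₁.mono hS'
  smooth_ψ₁ := h.smooth_ψ₁.mono hS'
  even_u₁ t ht := h.even_u₁ t (hS' ht)
  even_ω₁ t ht := h.even_ω₁ t (hS' ht)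
  even_ψ₁ t ht := h.even_ψ₁ t (hS' ht)
  equations t ht q hq := by
    obtain ⟨h1, h2, h3⟩ := h.equations t (hS' ht) q hq
    refine ⟨?_, ?_, h3⟩
    · rw [h.smooth_u₁.timeDerivWithin_eq_of_subset hS' hU ht q]; exact h1
    · rw [h.smooth_ω₁.timeDerivWithin_eq_of_subset hS' hU ht q]; exact h2

/-! ### Kinetic energy and decay of the datum -/

/-- **Kinetic energy** of a time slice `(u₁, ψ₁)` at real dimension `n`:
`E = ∫∫_{r>0, z∈ℝ} (|u^r|² + |u^θ|² + |u^z|²) r^{n−2} dr dz` with `u^r = −rψ₁,z`, `u^θ = r u₁ = Γ/r`,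
`u^z = (n−1)ψ₁ + rψ₁,r` (arXiv:2405.10916, §1 p. 3 and §2.3 p. 8: "the familiar kinetic energy
`∫ |u|² r^{n−2} dr dz` in `n` dimensions", equal to `∫ (u₁² + |∇ψ₁|²) rⁿ dr dz` and
conserved/dissipated for smooth solutions at fixed `n`; no factor `½` and no angular measure
`|S^{n−2}|`, as printed). Lower Lebesgue integral over `(0,∞) × ℝ`, weight `r^{n−2}` as a real
power. [cite: Hou2026, §2.3 p. 8] -/
def energy (n : ℝ) (u₁ ψ₁ : ℝ × ℝ → ℝ) : ℝ≥0∞ :=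
  ∫⁻ q in Ioi (0 : ℝ) ×ˢ (univ : Set ℝ),
    ENNReal.ofReal ((radialVel ψ₁ q ^ 2 + swirlVel u₁ q ^ 2 + axialVel n ψ₁ q ^ 2) *
      q.1 ^ (n - 2))

/-- Schwartz-type decay of a profile `G` on the meridian plane: `(1 + ‖q‖)^K ‖D^k G(q)‖ ≤ C_{k,K}`
for all `k`, `K` (the shape of `HasRapidSpatialDecay`, Fefferman's (4), on `ℝ × ℝ`; for profiles
even in `r` this is decay on the closed half-plane). [folklore] -/
def HasRapidDecay (G : ℝ × ℝ → ℝ) : Prop :=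
  ∀ k K : ℕ, ∃ C : ℝ, ∀ q : ℝ × ℝ, (1 + ‖q‖) ^ K * ‖iteratedFDeriv ℝ k G q‖ ≤ C

/-- **Rapidly decaying velocity** of a time slice `(u₁, ψ₁)` at dimension `n`: the three physical
velocity components `u^r = −rψ₁,z`, `u^θ = r u₁`, `u^z = (n−1)ψ₁ + rψ₁,r` have Schwartz-type decay
on the meridian plane (the counterpart of `HasRapidSpatialDecay (u 0)` for the datum). [folklore] -/
def HasRapidlyDecayingVelocity (n : ℝ) (u₁ ψ₁ : ℝ × ℝ → ℝ) : Prop :=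
  HasRapidDecay (radialVel ψ₁) ∧ HasRapidDecay (swirlVel u₁) ∧ HasRapidDecay (axialVel n ψ₁)

/-! ### Continuation vocabulary -/

/-- The classical solution `(u₁, ω₁, ψ₁)` on `[0, T)` **extends smoothly past `T`**: there are
`T' > T` and a classical solution of the same system (same `n`, `ν`) on `[0, T')` agreeing with
`(u₁, ω₁, ψ₁)` on `[0, T)` (verbatim parallel to `HasSmoothExtensionPast`, Beale–Kato–Majda 1984
§1). [folklore] -/
def HasSmoothExtensionPast (n ν : ℝ) (u₁ ω₁ ψ₁ : ℝ → ℝ × ℝ → ℝ) (T : ℝ) : Prop :=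
  ∃ T' > T, ∃ u₁' ω₁' ψ₁' : ℝ → ℝ × ℝ → ℝ,
    IsClassicalSolutionOn (Ico 0 T') n ν u₁' ω₁' ψ₁' ∧
      ∀ t ∈ Ico 0 T, u₁' t = u₁ t ∧ ω₁' t = ω₁ t ∧ ψ₁' t = ψ₁ t

/-- `(u₁, ω₁, ψ₁)` is a **maximal classical solution with lifespan `T`**: classical on `[0, T)`
and admitting no classical extension past `T` (parallel to `IsMaximalSmoothSolution`; meaningful
for `0 < T`, a global solution is never maximal in this finite-`T` sense). [folklore] -/
def IsMaximalSolution (n ν : ℝ) (u₁ ω₁ ψ₁ : ℝ → ℝ × ℝ → ℝ) (T : ℝ) : Prop :=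
  IsClassicalSolutionOn (Ico 0 T) n ν u₁ ω₁ ψ₁ ∧ ¬ HasSmoothExtensionPast n ν u₁ ω₁ ψ₁ T

/-- A maximal solution is a classical solution on `[0, T)` (field projection). [folklore] -/
theorem IsMaximalSolution.isClassicalSolutionOn {T : ℝ} (h : IsMaximalSolution n ν u₁ ω₁ ψ₁ T) :
    IsClassicalSolutionOn (Ico 0 T) n ν u₁ ω₁ ψ₁ :=
  h.1

/-- A classical solution on a longer interval `[0, T')`, `T < T'`, extends (its own restriction)
past `T`. [folklore] -/
theorem IsClassicalSolutionOn.hasSmoothExtensionPast {T T' : ℝ} (hTT' : T < T')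
    (h : IsClassicalSolutionOn (Ico 0 T') n ν u₁ ω₁ ψ₁) : HasSmoothExtensionPast n ν u₁ ω₁ ψ₁ T :=
  ⟨T', hTT', u₁, ω₁, ψ₁, h, fun _ _ => ⟨rfl, rfl, rfl⟩⟩

/-- A classical solution on `[0, T')` is not maximal with any shorter lifespan `T < T'`. [folklore] -/
theorem IsClassicalSolutionOn.not_isMaximalSolution {T T' : ℝ} (hTT' : T < T')
    (h : IsClassicalSolutionOn (Ico 0 T') n ν u₁ ω₁ ψ₁) : ¬ IsMaximalSolution n ν u₁ ω₁ ψ₁ T :=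
  fun hmax => hmax.2 (h.hasSmoothExtensionPast hTT')

/-! ### The circulation form (1.1) of the swirl equation -/

/-- `Γ_t = r² u₁,t` (one-sided time derivative; no hypotheses). [folklore] -/
theorem timeDerivWithin_circulation (S : Set ℝ) (u₁ : ℝ → ℝ × ℝ → ℝ) (t : ℝ) (q : ℝ × ℝ) :
    timeDerivWithin S (circulation u₁) t q = q.1 ^ 2 * timeDerivWithin S u₁ t q := by
  simp only [timeDerivWithin_apply, circulation]
  exact derivWithin_const_mul_field (q.1 ^ 2)

/-- **(1.1) ⇔ (2.x) off the axis.** For a smooth slice `u₁ t` and `r ≠ 0`, Hou's `Γ`-equation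
`Γ_t + u^rΓ_r + u^zΓ_z = ν(Γ_rr + ((n−4)/r)Γ_r + ((6−2n)/r²)Γ + Γ_zz)` for `Γ = r²u₁` holds at
`(t, r, z)` iff the `u₁`-equation `u₁,t + u^ru₁,r + u^zu₁,z = 2u₁ψ₁,z + ν(u₁,rr + (n/r)u₁,r + u₁,zz)`
does (arXiv:2405.10916, (1.1) p. 3 and §2.3 p. 8: "We first rewrite the `Γ`-equation in terms
of `u₁`"; the algebra: `Γ_r = 2ru₁ + r²u₁,r`, `Γ_rr = 2u₁ + 4ru₁,r + r²u₁,rr`, and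
`u^r Γ_r = r² u^r u₁,r − 2r²ψ₁,z u₁`). [cite: Hou2026, §2.3 p. 8] -/
theorem circulation_eq_iff {S : Set ℝ} {n ν : ℝ} {u₁ ψ₁ : ℝ → ℝ × ℝ → ℝ} {t : ℝ}
    (hu : ContDiff ℝ ∞ (u₁ t)) {q : ℝ × ℝ} (hq : q.1 ≠ 0) :
    (timeDerivWithin S (circulation u₁) t q +
          radialVel (ψ₁ t) q * derivR (circulation u₁ t) q +
          axialVel n (ψ₁ t) q * derivZ (circulation u₁ t) q =
        ν * (derivR (derivR (circulation u₁ t)) q + (n - 4) / q.1 * derivR (circulation u₁ t) q +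
          (6 - 2 * n) / q.1 ^ 2 * circulation u₁ t q + derivZ (derivZ (circulation u₁ t)) q)) ↔
      timeDerivWithin S u₁ t q + radialVel (ψ₁ t) q * derivR (u₁ t) q +
          axialVel n (ψ₁ t) q * derivZ (u₁ t) q =
        2 * u₁ t q * derivZ (ψ₁ t) q + ν * lap n (u₁ t) q := by
  have e0 : circulation u₁ t = fun q' => q'.1 ^ 2 * u₁ t q' := rfl
  rw [timeDerivWithin_circulation, e0, derivR_sq_mul hu, derivZ_sq_mul hu, derivR_derivR_sq_mul hu,
    derivZ_derivZ_sq_mul hu]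
  simp only [lap, radialVel, axialVel]
  set r := q.1
  set u := u₁ t q
  set R := derivR (u₁ t) q
  set Z := derivZ (u₁ t) q
  set RR := derivR (derivR (u₁ t)) q
  set ZZ := derivZ (derivZ (u₁ t)) q
  set T := timeDerivWithin S u₁ t q
  set P := ψ₁ t q
  set PR := derivR (ψ₁ t) q
  set PZ := derivZ (ψ₁ t) q
  have e1 : (r ^ 2 * T + -(r * PZ) * (2 * r * u + r ^ 2 * R) + ((n - 1) * P + r * PR) * (r ^ 2 * Z)) -
        ν * (2 * u + 4 * r * R + r ^ 2 * RR + (n - 4) / r * (2 * r * u + r ^ 2 * R) +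
          (6 - 2 * n) / r ^ 2 * (r ^ 2 * u) + r ^ 2 * ZZ) =
      r ^ 2 * ((T + -(r * PZ) * R + ((n - 1) * P + r * PR) * Z) -
        (2 * u * PZ + ν * (RR + n / r * R + ZZ))) := by
    field_simp
    ring
  rw [← sub_eq_zero, e1, mul_eq_zero, sub_eq_zero, or_iff_right (pow_ne_zero 2 hq)]

/-- **The circulation equation (1.1) for classical solutions.** For a classical solution,
`t ∈ S` and `r > 0`, the total circulation `Γ = r² u₁` satisfies Hou's (1.1):
`Γ_t + u^r Γ_r + u^z Γ_z = ν (Γ_rr + ((n−4)/r) Γ_r + ((6−2n)/r²) Γ + Γ_zz)`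
(arXiv:2405.10916, §1 (1.1), p. 3). [cite: Hou2026, §1 eq. (1.1)] -/
theorem IsClassicalSolutionOn.circulation_eq {S : Set ℝ} {n ν : ℝ} {u₁ ω₁ ψ₁ : ℝ → ℝ × ℝ → ℝ}
    (h : IsClassicalSolutionOn S n ν u₁ ω₁ ψ₁) {t : ℝ} (ht : t ∈ S) {q : ℝ × ℝ} (hq : 0 < q.1) :
    timeDerivWithin S (circulation u₁) t q +
        radialVel (ψ₁ t) q * derivR (circulation u₁ t) q +
        axialVel n (ψ₁ t) q * derivZ (circulation u₁ t) q =
      ν * (derivR (derivR (circulation u₁ t)) q + (n - 4) / q.1 * derivR (circulation u₁ t) q +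
        (6 - 2 * n) / q.1 ^ 2 * circulation u₁ t q + derivZ (derivZ (circulation u₁ t)) q) :=
  (circulation_eq_iff (h.contDiff_u₁ ht) hq.ne').2 (h.equations t ht q hq).swirl_eq

/-- **The source term of (1.2)**: off the axis `(Γ²/r⁴)_z = (u₁²)_z` (arXiv:2405.10916, (1.2)
p. 3 vs. p. 8), since `Γ²/r⁴ = u₁²` on the open set `{r ≠ 0}`. [cite: Hou2026, §1 eq. (1.2)] -/
theorem derivZ_circulation_sq_div (u₁ : ℝ → ℝ × ℝ → ℝ) (t : ℝ) {q : ℝ × ℝ} (hq : q.1 ≠ 0) :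
    derivZ (fun q' => circulation u₁ t q' ^ 2 / q'.1 ^ 4) q = derivZ (fun q' => u₁ t q' ^ 2) q := by
  have hO : IsOpen {q' : ℝ × ℝ | q'.1 ≠ 0} := isOpen_ne_fun continuous_fst continuous_const
  have hev : (fun q' => circulation u₁ t q' ^ 2 / q'.1 ^ 4) =ᶠ[nhds q] fun q' => u₁ t q' ^ 2 := by
    filter_upwards [hO.mem_nhds hq] with q' (hq' : q'.1 ≠ 0)
    rw [circulation_apply, div_eq_iff (pow_ne_zero 4 hq')]
    ring
  simp only [derivZ, hev.fderiv_eq]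

/-! ### `n = 3`: the axisymmetric velocity field on `ℝ³` -/

/-- Local notation for physical space `ℝ³ = EuclideanSpace ℝ (Fin 3)`. -/
local notation "ℝ³" => EuclideanSpace ℝ (Fin 3)

/-- **The axisymmetric velocity field of a time slice at `n = 3`**:
`u(x) = u^r(r,z) e_r + r u₁(r,z) e_θ + u^z(r,z) e_z`, `(r, z) = meridian x`, in the tree's
cylindrical frame `eR`, `eTheta`, `eZ` (`u^θ = r u₁`, `u^r = −rψ₁,z`, `u^z = 2ψ₁ + rψ₁,r`;
arXiv:2405.10916, p. 7). On the axis `eR = eTheta = 0` are junk-free here since `u^r = u^θ = 0`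
at `r = 0`. [cite: Hou2026, §2 p. 7] -/
def toVelocity (u₁ ψ₁ : ℝ × ℝ → ℝ) (x : ℝ³) : ℝ³ :=
  radialVel ψ₁ (meridian x) • eR x + swirlVel u₁ (meridian x) • eTheta x +
    axialVel 3 ψ₁ (meridian x) • eZ

/-- **`Γ = r u^θ = r² u₁`**: the tree's swirl `swirl u = x₀u₁ − x₁u₀` of the reconstructed field is
the circulation `r² u₁(r, z)` (arXiv:2405.10916, §1 p. 3: `Γ = r u^θ`, `u₁ = u^θ/r`).
[cite: Hou2026, §1 p. 3] -/
theorem swirl_toVelocity (u₁ ψ₁ : ℝ × ℝ → ℝ) (x : ℝ³) :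
    swirl (toVelocity u₁ ψ₁) x = cylRadius x ^ 2 * u₁ (meridian x) := by
  have h0 : toVelocity u₁ ψ₁ x 0 = radialVel ψ₁ (meridian x) * ((cylRadius x)⁻¹ * x 0) +
      swirlVel u₁ (meridian x) * (-(cylRadius x)⁻¹ * x 1) := by
    simp [toVelocity, eR, eTheta, eZ]
  have h1 : toVelocity u₁ ψ₁ x 1 = radialVel ψ₁ (meridian x) * ((cylRadius x)⁻¹ * x 1) +
      swirlVel u₁ (meridian x) * ((cylRadius x)⁻¹ * x 0) := by
    simp [toVelocity, eR, eTheta, eZ]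
  rw [swirl, h0, h1]
  by_cases hx : cylRadius x = 0
  · obtain ⟨hx0, hx1⟩ := (cylRadius_eq_zero_iff x).1 hx
    simp [hx0, hx1, hx]
  · simp only [swirlVel, meridian_apply]
    have hr2 : cylRadius x ^ 2 = x 0 ^ 2 + x 1 ^ 2 := cylRadius_sq x
    have h : cylRadius x * u₁ (cylRadius x, x 2) * ((cylRadius x)⁻¹ * x 0) =
        u₁ (cylRadius x, x 2) * x 0 := by
      field_simp
    have h' : cylRadius x * u₁ (cylRadius x, x 2) * (-(cylRadius x)⁻¹ * x 1) =
        -(u₁ (cylRadius x, x 2) * x 1) := by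
      field_simp
    rw [h, h', hr2]
    ring

/-- The axial component of the reconstructed field is `u^z(r, z)`. [folklore] -/
theorem toVelocity_apply_two (u₁ ψ₁ : ℝ × ℝ → ℝ) (x : ℝ³) :
    toVelocity u₁ ψ₁ x 2 = axialVel 3 ψ₁ (meridian x) := by
  simp [toVelocity, eR, eTheta, eZ]

/-! ### Odd `n = 2m+1`: Hopf-equivariant fields on `ℝ^{2m+1} = ℂ^m × ℝ`

Vocabulary (no claims) for the dictionary between solutions at odd real dimension `n = 2m+1` and
`U(m)`-equivariant vector fields on `ℝ^{2m+1}`: coordinates `x = (x₀, …, x_{2m})`, horizontal part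
`ζ = (x₀ + i x₁, …, x_{2m−2} + i x_{2m−1}) ∈ ℂ^m`, axial coordinate `z = x_{2m}`, the complex
structure `J` (`J(x_{2j}, x_{2j+1}) = (−x_{2j+1}, x_{2j})`, the Hopf field `x ↦ Jζ`), and the lift
`u = −ψ₁,z(ρ,z) ζ + u₁(ρ,z) Jζ + u^z(ρ,z) e_z`, `ρ = |ζ|` — i.e. `u^r ζ/|ζ| + (Γ/|ζ|²) Jζ + u^z e_z`
with `u^r = −ρψ₁,z`, `Γ = ρ²u₁`, written without divisions. For `m = 1` this is `toVelocity`
(`hopfLift_one`). The equivalence of the two notions of solution is **not** asserted here. -/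

section Hopf

open WithLp

variable (m : ℕ)

/-- Local notation for `ℝ^{2m+1}`. -/
local notation "𝔼" => EuclideanSpace ℝ (Fin (2 * m + 1))

/-- The axial unit vector `e_z = e_{2m}` of `ℝ^{2m+1}`. [folklore] -/
def hopfAxis : 𝔼 :=
  EuclideanSpace.single (Fin.last (2 * m)) 1

/-- The axial coordinate `z = x_{2m}`. [folklore] -/
def hopfZ (x : 𝔼) : ℝ :=
  x (Fin.last (2 * m))

/-- The horizontal part `ζ = (x₀, …, x_{2m−1}, 0)` of `x` (last coordinate set to `0`). [folklore] -/
def hopfHoriz (x : 𝔼) : 𝔼 :=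
  x - hopfZ m x • hopfAxis m

/-- The complex structure `J` on the horizontal hyperplane `ℂ^m = {x_{2m} = 0}`, extended by `0`
on the axis direction: `(Jx)_{2j} = −x_{2j+1}`, `(Jx)_{2j+1} = x_{2j}` (`j < m`), `(Jx)_{2m} = 0`;
`x ↦ J x` restricted to spheres `|ζ| = const` is the Hopf vector field. [folklore] -/
def hopfJ (x : 𝔼) : 𝔼 :=
  toLp 2 fun i : Fin (2 * m + 1) =>
    if h : i.val < 2 * m then
      (if i.val % 2 = 0 then -x ⟨i.val + 1, by omega⟩ else x ⟨i.val - 1, by omega⟩)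
    else 0

/-- **The Hopf lift** of a slice `(u₁, ψ₁)` at odd dimension `n = 2m+1`: the vector field
`u(x) = −ψ₁,z(ρ, z) ζ + u₁(ρ, z) Jζ + u^z(ρ, z) e_z` on `ℝ^{2m+1}`, `ρ = |ζ|`, `z = x_{2m}`,
`u^z = axialVel (2m+1) ψ₁` — the field with radial velocity `u^r = −ρψ₁,z` along `ζ/|ζ|`, swirl
`u^θ = ρ u₁` along the Hopf direction `Jζ/|ζ|`, and axial velocity `u^z`. [folklore] -/
def hopfLift (u₁ ψ₁ : ℝ × ℝ → ℝ) (x : 𝔼) : 𝔼 :=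
  (-derivZ ψ₁ (‖hopfHoriz m x‖, hopfZ m x)) • hopfHoriz m x +
    u₁ (‖hopfHoriz m x‖, hopfZ m x) • hopfJ m x +
      axialVel (2 * m + 1) ψ₁ (‖hopfHoriz m x‖, hopfZ m x) • hopfAxis m

/-- A vector field on `ℝ^{2m+1}` is **Hopf-equivariant** (`U(m)`-equivariant) if
`u (A x) = A (u x)` for every linear isometry `A` fixing the axis `e_z` and commuting with `J`
(these isometries preserve the horizontal hyperplane and are complex-linear on it: the unitary
group `U(m)`; for `m = 1`, the rotations about the axis). [folklore] -/
def IsHopfEquivariant (u : 𝔼 → 𝔼) : Prop :=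
  ∀ A : 𝔼 →ₗᵢ[ℝ] 𝔼, A (hopfAxis m) = hopfAxis m → (∀ x, A (hopfJ m x) = hopfJ m (A x)) →
    ∀ x, u (A x) = A (u x)

/-- The axial component of the Hopf lift is `u^z(ρ, z)`. [folklore] -/
theorem hopfLift_apply_last (u₁ ψ₁ : ℝ × ℝ → ℝ) (x : 𝔼) :
    hopfLift m u₁ ψ₁ x (Fin.last (2 * m)) =
      axialVel (2 * m + 1) ψ₁ (‖hopfHoriz m x‖, hopfZ m x) := by
  simp [hopfLift, hopfHoriz, hopfJ, hopfAxis, hopfZ]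

end Hopf

open WithLp in
/-- For `m = 1` (`n = 3`) the Hopf lift is the axisymmetric field `toVelocity`
(`ζ = (x₀, x₁, 0)`, `|ζ| = r`, `Jζ = (−x₁, x₀, 0) = r e_θ`, `e_z = e₂`). [folklore] -/
theorem hopfLift_one (u₁ ψ₁ : ℝ × ℝ → ℝ) (x : EuclideanSpace ℝ (Fin 3)) :
    hopfLift 1 u₁ ψ₁ x = toVelocity u₁ ψ₁ x := by
  have hH : hopfHoriz 1 x = toLp 2 ![x 0, x 1, 0] := by
    ext i
    fin_cases i <;> simp [hopfHoriz, hopfZ, hopfAxis, Fin.last]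
  have hJ : hopfJ 1 x = toLp 2 ![-x 1, x 0, 0] := by
    ext i
    fin_cases i <;> simp [hopfJ]
  have hn : ‖(toLp 2 ![x 0, x 1, 0] : EuclideanSpace ℝ (Fin 3))‖ = cylRadius x := by
    rw [EuclideanSpace.norm_eq, cylRadius]
    congr 1
    simp [Fin.sum_univ_three]
  have hz : hopfZ 1 x = x 2 := rfl
  rw [hopfLift, hH, hJ, hn, hz]
  ext i
  fin_cases i
  · by_cases hx : cylRadius x = 0
    · obtain ⟨h0, h1⟩ := (cylRadius_eq_zero_iff x).1 hx
      simp [toVelocity, radialVel, swirlVel, eR, eTheta, eZ, hopfAxis, h0, h1, Fin.last]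
    · simp [toVelocity, radialVel, swirlVel, eR, eTheta, eZ, hopfAxis, Fin.last]
      field_simp
  · by_cases hx : cylRadius x = 0
    · obtain ⟨h0, h1⟩ := (cylRadius_eq_zero_iff x).1 hx
      simp [toVelocity, radialVel, swirlVel, eR, eTheta, eZ, hopfAxis, h0, h1, Fin.last]
    · simp [toVelocity, radialVel, swirlVel, eR, eTheta, eZ, hopfAxis, Fin.last]
      field_simp
  · simp [toVelocity, radialVel, swirlVel, eR, eTheta, eZ, hopfAxis, Fin.last, axialVel]
    norm_num

end GeneralizedAxisymNS

end Literature.Analysis.FluidPDE
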